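import Summits.QuantumFields.BalabanUV.T4Continuum.Spine.NE2BalabanHodge
import Summits.QuantumFields.BalabanUV.T4Continuum.Support.ShiftedZerothOrder

/-!
# T⁴ programme, spine node NE2 (U1a), tier B — THE HODGE-FORM VARIANT WITH ITS MIXED-SHIFT BINDER `hS` DISCHARGED BY NAME
# (`ShiftedZerothOrder.shiftLaws_mixed`, `cm = 2·Cst`)

Tenth generation of the NE2 prover lineage P1 of the cell `pub-balaban` (row owner), file 8.  The Hodge-form lane of tier B — row B2.w-laws
`Support/HodgeCorrectionLaws.perturbationLaws_hodgeCorrection_of_shiftLaws` (leaf-10-g2), its feed `Support/HolonomyTowerRegular(Bridge)`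
(leaf-10-g2), the alternative B2 slot `Support/HodgeModelSlot.perturbationLaws_hodgeModel` (leaf-10-g2) and the variant of ROOT B
`Spine/NE2BalabanHodge.{perturbationLaws_balaban_hodge, balaban_hodge_rate, balaban_hodge_rate_of_regular}` (leaf-08-g2) — was written GENERIC in
one binder `hS : ∀ μ ν, ShiftLaws L M a ha (k ↦ ((S_μ)ᴴ S_ν) ⊗ₖ 1) cm` (the sandwiched two-level intertwining law of the MIXED two-step lattice
shifts), because the owner's supplier `ShiftedZerothOrder` v1.1 (`Smix`, `shiftLaws_mixed : ShiftLaws … (Smix μ ν) (2 * Cst d a)`) was still in the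
review lane (referee `t4/formal/NE2/REFEREE.md` passes 6–10, condition c11: «`hS` undischarged on the variant; re-check when `shiftLaws_mixed` lands»).
It has landed (p209079).  THIS FILE substitutes `hS := shiftLaws_mixedShift` and `cm := 2·Cst d a` in the six statements and changes NOTHING ELSE:
every other binder (`hz` / `hreg₂ : RegularSites Rb α β β₂` / `hNE3₂ : LocalRate (bgReadings (regClass₂ Rb)) C L⁻¹` / `0 < a′` / the B4 thresholds /
the two explicit η-thresholds) is passed through VERBATIM, every conclusion is the original one at `cm = 2·Cst d a`.

 * §0 `shiftLaws_mixedShift` — `shiftLaws_mixed` in the consumers' unfolded spelling of `Smix` (definitional).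
 * §1 `perturbationLaws_hodgeCorrection` (row B2.w-laws' END, `hz` only), `perturbationLaws_hodgeCorrection_of_regular_localRate` (`hreg₂`, `hNE3₂`),
   `perturbationLaws_hodgeModel` (the alternative B2 slot: `hreg₂`, `hNE3₂`).
 * §2 `perturbationLaws_balaban_hodge`, `balaban_hodge_rate`, **`balaban_hodge_rate_of_regular`** — the Hodge-form variant of ROOT B with displayed
   binders `hreg₂`, `hNE3₂` (node NE3 BY NAME on `regClass₂`, OPEN), `0 < a′`, `α ≤ η`, `β ≤ η`, `η ≤ etaStar o d a a′`, `η ≤ 1/(8(d²·Cst + 1))` and NO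
   shift-law binder.

HONEST FRAMING (T4-DAG p. 1).  This closes ONLY the `hS` residue of referee condition c11; c11's NE3-side content (the variant asks node NE3 on the
LARGER class `regClass₂ ⊋ regClass`) is untouched and displayed; the Hodge form stays a VARIANT of the B2 slot, off the instance of record
`NE2BalabanThreshold.balaban_final_rate_of_regular` (owner ruling R16; no identification of either form with [Balaban1985BackgroundPropagators]
(3.10) is asserted — dictionary B0, trigger c5; the carver's scope ruling c1 is owed); composition BY NAME; `Rb`, `a′` DATA; GLOBAL small field;
finite torus, linear layer, operator norm; NE2 (U1a) NOT PROVED; spine PROVED 0/9 unchanged; NOT infinite volume / mass gap / Clay.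
HONEST DEPENDENCY: continuum YM on T⁴ ⇐ BetaPertH ∧ nine spine estimates (0/9 proved); BetaPertH ⇐ (D1) ∧ (D4) ∧ CAP+tail; G-an2-4 gates asym, D1
and NE2/3/4.  No definition, no `def … : Prop` fact, no `sorry`.
-/

noncomputable section

open scoped BigOperators ComplexConjugate Matrix Matrix.Norms.L2Operator Kronecker
open Filter Topology

namespace Summit.QuantumFields.BalabanUV.T4Continuum.NE2BalabanHodgeShift

open Literature.MathematicalPhysics.QuantumFieldTheory.Balaban1983to89.B5Prop11Plancherel (Cst Cst_nonneg Tor fine shiftM)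
open Literature.MathematicalPhysics.QuantumFieldTheory.Balaban1983to89.B5G183RateUnitTower (lev lev_neZero)
open Literature.MathematicalPhysics.QuantumFieldTheory.Balaban1983to89.T4EtaRateMin (LocalRate)
open Summit.QuantumFields.BalabanUV.T4Continuum
open Summit.QuantumFields.BalabanUV.T4Continuum.CovariantAveragingTower (TowerLimitRate)
open Summit.QuantumFields.BalabanUV.T4Continuum.BalabanAveragedTowerUnit (idx Qlev)
open Summit.QuantumFields.BalabanUV.T4Continuum.BackgroundResolventTower
open Summit.QuantumFields.BalabanUV.T4Continuum.KingPairingPlantedLaw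
open Summit.QuantumFields.BalabanUV.T4Continuum.GramPerturbationLaw (C2gram)
open Summit.QuantumFields.BalabanUV.T4Continuum.NE2FromNE3 (bgReadings)
open Summit.QuantumFields.BalabanUV.T4Continuum.CovariantAveragingSummand (kappaQ)
open Summit.QuantumFields.BalabanUV.T4Continuum.ColourCovariantLaplacian (BoundedBackgroundM covPertC kappaCol C2col)
open Summit.QuantumFields.BalabanUV.T4Continuum.TransportedSiteAveraging (Dc Jc)
open Summit.QuantumFields.BalabanUV.T4Continuum.RegularBackgroundTower (betaNE3)
open Summit.QuantumFields.BalabanUV.T4Continuum.ShiftedZerothOrder (ShiftLaws Smix shiftLaws_mixed)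
open Summit.QuantumFields.BalabanUV.T4Continuum.HodgeCorrectionLaws (holTower hodgeCorr perturbationLaws_hodgeCorrection_of_shiftLaws)
open Summit.QuantumFields.BalabanUV.T4Continuum.HolonomyTowerRegular
open Summit.QuantumFields.BalabanUV.T4Continuum.HodgeModelSlot (hodgePert)
open Summit.QuantumFields.BalabanUV.T4Continuum.GaugeTermPerturbationLaw (deltaK)
open Summit.QuantumFields.BalabanUV.T4Continuum.GaugeTermScalarData (QuT Q1)
open Summit.QuantumFields.BalabanUV.T4Continuum.GaugeTermInstanceGeom (gS)
open Summit.QuantumFields.BalabanUV.T4Continuum.ScalarAveragedCompression (sigma0)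
open Summit.QuantumFields.BalabanUV.T4Continuum.ScalarCovariantLaplacian (kappaS)
open Summit.QuantumFields.BalabanUV.T4Continuum.RegularSiteTransporters (siteT)
open Summit.QuantumFields.BalabanUV.T4Continuum.NestedContourTransport (theta0)
open Summit.QuantumFields.BalabanUV.T4Continuum.NE2BalabanRoot (avgPert balabanPert)
open Summit.QuantumFields.BalabanUV.T4Continuum.NE2BalabanGauge (gaugeSlot liftR)
open Summit.QuantumFields.BalabanUV.T4Continuum.NE2BalabanLayerSharp (kappaBs C2Bs)
open Summit.QuantumFields.BalabanUV.T4Continuum.NE2BalabanWiring (epsR CdeltaR)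
open Summit.QuantumFields.BalabanUV.T4Continuum.NE2BalabanFinal (tauR kappa4F C4F)
open Summit.QuantumFields.BalabanUV.T4Continuum.NE2BalabanThreshold (etaStar)

variable {d : ℕ} (L : ℕ) [NeZero L] (M : Fin d → ℕ) [hM : ∀ μ, NeZero (M μ)] (a : ℝ) (ha : 0 < a)
variable {o : Type*} [Fintype o] [DecidableEq o]

/-! ## §0 The mixed-shift law, in the consumers' spelling -/

/-- **THE MIXED TWO-STEP SHIFTS OBEY `ShiftLaws` WITH `ct = 2·Cst`**, stated on the unfolded carrier `k ↦ ((S_μ)ᴴ * S_ν) ⊗ₖ 1` that the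
Hodge-lane ENDs quantify over (`= ShiftedZerothOrder.Smix L M μ ν` by `rfl`); this is `ShiftedZerothOrder.shiftLaws_mixed` verbatim. [folklore] -/
theorem shiftLaws_mixedShift (μ ν : Fin d) :
    ShiftLaws L M a ha (fun k => ((shiftM (fine (lev L k) M) μ)ᴴ * shiftM (fine (lev L k) M) ν) ⊗ₖ (1 : Matrix o o ℂ)) (2 * Cst d a) :=
  shiftLaws_mixed L M a ha μ ν

/-! ## §1 Row B2.w's law and the alternative B2 slot without the shift binder -/

variable {Rb : (k : ℕ) → Fin d → Tor (fine (lev L k) M) → Matrix o o ℂ} {α β β₂ : ℝ}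

/-- **`PerturbationLaws` FOR THE WEITZENBÖCK CORRECTION FROM THE HOLONOMY DATA ALONE** (row B2.w-laws' END with `hS` discharged): if the `d²`
holonomy towers are bounded two-level-consistent colour data (`hz`, NE3's currency), then
`PerturbationLaws (Δ_a⊗1) (hodgeCorr Rb) (J⊗1) (d²·α·Cst) (k ↦ d²·Cst·(2α·Cst + β·Cst)·L^{−k})`. [folklore] -/
theorem perturbationLaws_hodgeCorrection (hz : ∀ ν μ, BoundedBackgroundM L M (holTower L M Rb ν μ) α β) :
    PerturbationLaws (Dc L M a ha) (hodgeCorr L M Rb) (Jc L M)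
      ((d : ℝ) ^ 2 * (α * Cst d a)) (fun k => (d : ℝ) ^ 2 * (Cst d a * (α * (2 * Cst d a) + β * Cst d a)) * ((L : ℝ)⁻¹) ^ k) :=
  perturbationLaws_hodgeCorrection_of_shiftLaws L M a ha hz (shiftLaws_mixedShift L M a ha)

/-- **ROW B2.w's LAW WITH ROW B2's BINDER SHAPES AND NO SHIFT BINDER**: `hreg₂ : RegularSites Rb α β β₂` ((3.35)+(3.36) shapes) and
`hNE3₂ : LocalRate (bgReadings (regClass₂ Rb)) C L⁻¹` (node NE3 BY NAME on `{w} ∪ {D_lam w}`, OPEN) ⟹ the target shape for `hodgeCorr L M Rb` with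
`κ_w = d²(2β + 2α²)Cst`, `C_w = d²·Cst·((2β + 2α²)·2Cst + (2(βNE3 + β₂) + 4α(βNE3 + β))·Cst)`, `βNE3 = betaNE3 o C`. [folklore] -/
theorem perturbationLaws_hodgeCorrection_of_regular_localRate (h : RegularSites L M Rb α β β₂) {C : ℝ} (hC : 0 ≤ C)
    (hNE3 : LocalRate (bgReadings L M (regClass₂ L M Rb)) C ((L : ℝ)⁻¹)) :
    PerturbationLaws (Dc L M a ha) (hodgeCorr L M Rb) (Jc L M)
      ((d : ℝ) ^ 2 * ((2 * β + 2 * α ^ 2) * Cst d a))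
      (fun k => (d : ℝ) ^ 2 * (Cst d a * ((2 * β + 2 * α ^ 2) * (2 * Cst d a)
        + (2 * (betaNE3 o C + β₂) + 4 * α * (betaNE3 o C + β)) * Cst d a)) * ((L : ℝ)⁻¹) ^ k) :=
  HolonomyTowerRegular.perturbationLaws_hodgeCorrection_of_regular_localRate a ha h hC hNE3 (shiftLaws_mixedShift L M a ha)

/-- **THE HODGE-FORM MODEL's `PerturbationLaws` — THE ALTERNATIVE B2 SLOT WITHOUT THE SHIFT BINDER** (`d ≥ 1`): `hreg₂`, `hNE3₂` ⟹ the target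
shape for `hodgePert L M Rb = covPertC + hodgeCorr` with `κ = κ_col + d²(2β + 2α²)Cst`, `C₂ = C₂^col + C_w` at `cm = 2Cst`.  A VARIANT of the B2
slot; NOT NE2; no B0. [folklore] -/
theorem perturbationLaws_hodgeModel (hd : 1 ≤ d) (h : RegularSites L M Rb α β β₂) {C : ℝ} (hC : 0 ≤ C)
    (hNE3 : LocalRate (bgReadings L M (regClass₂ L M Rb)) C ((L : ℝ)⁻¹)) :
    PerturbationLaws (fun k => calDalev L M a ha k ⊗ₖ (1 : Matrix o o ℂ)) (hodgePert L M Rb) (fun k => JpcT L M k ⊗ₖ (1 : Matrix o o ℂ))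
      (kappaCol o d a α (max β (betaNE3 o C)) (d * (α ^ 2 + 2 * β)) + (d : ℝ) ^ 2 * ((2 * β + 2 * α ^ 2) * Cst d a))
      (fun k => C2col o d L a α (max β (betaNE3 o C)) (d * (2 * α * (betaNE3 o C + β) + 2 * (betaNE3 o C + β₂))) * ((L : ℝ)⁻¹) ^ k
        + (d : ℝ) ^ 2 * (Cst d a * ((2 * β + 2 * α ^ 2) * (2 * Cst d a)
          + (2 * (betaNE3 o C + β₂) + 4 * α * (betaNE3 o C + β)) * Cst d a)) * ((L : ℝ)⁻¹) ^ k) :=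
  HodgeModelSlot.perturbationLaws_hodgeModel L M a ha hd h hC hNE3 (shiftLaws_mixedShift L M a ha)

/-! ## §2 The Hodge-form variant of ROOT B without the shift binder -/

/-- **`PerturbationLaws` FOR THE HODGE-FORM TIER-B PERTURBATION WITHOUT THE SHIFT BINDER** (`d ≥ 1`): displayed binders `hreg₂ : RegularSites Rb α β β₂`,
`hNE3₂ : LocalRate (bgReadings (regClass₂ Rb)) C L⁻¹` (node NE3, OPEN), `0 < a′`, the B4 thresholds ⟹ the target shape for
`k ↦ balabanPert (liftR Rb) (gaugeSlot …) k + hodgeCorr Rb k` with `κ_H = κ_B + d²(2β + 2α²)Cst`, `C₂^H = C₂^B(C₁) + C_w` at `cm = 2Cst`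
(`NE2BalabanHodge.perturbationLaws_balaban_hodge` with `hS := shiftLaws_mixedShift`).  A VARIANT (c11); NE2 NOT proved by this. [folklore] -/
theorem perturbationLaws_balaban_hodge (hd : 1 ≤ d) (h : RegularSites L M Rb α β β₂) {C : ℝ} (hC : 0 ≤ C)
    (hNE3 : LocalRate (bgReadings L M (regClass₂ L M Rb)) C ((L : ℝ)⁻¹)) {a' : ℝ} (ha' : 0 < a')
    (hκ : kappaS d a' α β (tauR d α) < 1)
    (hsmall : ((sigma0 d a') ^ 2)⁻¹ * deltaK (gS d a' (kappaS d a' α β (tauR d α))) (1 + tauR d α) (d * α) (tauR d α) a' < 1) :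
    PerturbationLaws (fun k => calDalev L M a ha k ⊗ₖ (1 : Matrix o o ℂ))
      (fun k => balabanPert L M a (liftR L M Rb) (gaugeSlot L M Rb (QuT L M o (siteT L M Rb)) (Q1 L M o) a') k + hodgeCorr L M Rb k)
      (fun k => JpcT L M k ⊗ₖ (1 : Matrix o o ℂ))
      (kappaBs o d a α β (kappaQ d a (a : ℂ) (epsR o d α)) (kappa4F d a a' α β) + (d : ℝ) ^ 2 * ((2 * β + 2 * α ^ 2) * Cst d a))
      (fun k => C2Bs o d L a α β (betaNE3 o C + β₂)
          (a * C2gram (Cst d a) 1 (epsR o d α) (2 * d * Cst d a) (CJ d a) (Cst d a)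
            (CdeltaR o d a α (theta0 d α (betaNE3 o (betaNE3 o C + β₂)))))
          (C4F o d L a a' α β (betaNE3 o C + β₂)) * ((L : ℝ)⁻¹) ^ k
        + (d : ℝ) ^ 2 * (Cst d a * ((2 * β + 2 * α ^ 2) * (2 * Cst d a)
          + (2 * (betaNE3 o C + β₂) + 4 * α * (betaNE3 o C + β)) * Cst d a)) * ((L : ℝ)⁻¹) ^ k) :=
  NE2BalabanHodge.perturbationLaws_balaban_hodge L M a ha hd h hC hNE3 ha' hκ hsmall (shiftLaws_mixedShift L M a ha)

/-- **THE η-RATE FOR THE HODGE-FORM VARIANT ON ITS NEUMANN DISC, WITHOUT THE SHIFT BINDER** (`L ≥ 2`, `d ≥ 1`): for every coupling with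
`‖t‖·κ_H < 1`, `TowerLimitRate (Qlev ⊗ 1) L^d (k ↦ (Δ_a^{(k)} ⊗ 1 + t·P_H k)⁻¹) (Cpert κ_H (2dCst) CJ C₂^H 0 t) L⁻¹` at `cm = 2Cst`
(`NE2BalabanHodge.balaban_hodge_rate` with `hS := shiftLaws_mixedShift`).  A VARIANT (c11); NE2 NOT proved by this. [folklore] -/
theorem balaban_hodge_rate (hL : 2 ≤ L) (hd : 1 ≤ d) (h : RegularSites L M Rb α β β₂) {C : ℝ} (hC : 0 ≤ C)
    (hNE3 : LocalRate (bgReadings L M (regClass₂ L M Rb)) C ((L : ℝ)⁻¹)) {a' : ℝ} (ha' : 0 < a')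
    (hκ : kappaS d a' α β (tauR d α) < 1)
    (hsmall : ((sigma0 d a') ^ 2)⁻¹ * deltaK (gS d a' (kappaS d a' α β (tauR d α))) (1 + tauR d α) (d * α) (tauR d α) a' < 1)
    {t : ℂ} (ht : ‖t‖ * (kappaBs o d a α β (a * (epsR o d α * (2 + epsR o d α) * Cst d a)) (kappa4F d a a' α β)
      + (d : ℝ) ^ 2 * ((2 * β + 2 * α ^ 2) * Cst d a)) < 1) :
    TowerLimitRate (fun k => Qlev L M k ⊗ₖ (1 : Matrix o o ℂ)) ((L : ℝ) ^ d)
      (fun k => (calDalev L M a ha k ⊗ₖ (1 : Matrix o o ℂ)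
        + t • (balabanPert L M a (liftR L M Rb) (gaugeSlot L M Rb (QuT L M o (siteT L M Rb)) (Q1 L M o) a') k + hodgeCorr L M Rb k))⁻¹)
      (Cpert (kappaBs o d a α β (a * (epsR o d α * (2 + epsR o d α) * Cst d a)) (kappa4F d a a' α β)
          + (d : ℝ) ^ 2 * ((2 * β + 2 * α ^ 2) * Cst d a)) (2 * d * Cst d a) (CJ d a)
        (C2Bs o d L a α β (betaNE3 o C + β₂)
            (a * C2gram (Cst d a) 1 (epsR o d α) (2 * d * Cst d a) (CJ d a) (Cst d a)
              (CdeltaR o d a α (theta0 d α (betaNE3 o (betaNE3 o C + β₂)))))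
            (C4F o d L a a' α β (betaNE3 o C + β₂))
          + (d : ℝ) ^ 2 * (Cst d a * ((2 * β + 2 * α ^ 2) * (2 * Cst d a)
            + (2 * (betaNE3 o C + β₂) + 4 * α * (betaNE3 o C + β)) * Cst d a)))
        0 t) ((L : ℝ)⁻¹) :=
  NE2BalabanHodge.balaban_hodge_rate L M a ha hL hd h hC hNE3 ha' hκ hsmall (shiftLaws_mixedShift L M a ha) ht

/-- **THE HODGE-FORM VARIANT OF ROOT B AT `t = 1` UNDER TWO EXPLICIT THRESHOLDS AND NO SHIFT BINDER** (`L ≥ 2`, `d ≥ 1`, `a′ > 0`): displayed binders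
`hreg₂ : RegularSites Rb α β β₂` ((3.35)+(3.36) shapes), `hNE3₂ : LocalRate (bgReadings (regClass₂ Rb)) C L⁻¹` (node NE3 BY NAME on the LARGER class,
OPEN), `α ≤ η`, `β ≤ η`, `η ≤ etaStar o d a a′`, `η ≤ 1/(8(d²Cst + 1))` ⟹ the lifted King-averaged unit-lattice covariances of
`(Δ_a^{(k)} ⊗ 1 + P_H k)⁻¹`, `P_H = hodgePert + avgPert + gaugeSlot` (`NE2BalabanHodge.balabanHodge_eq`), CONVERGE with rate `L^{−k}` — the mixed-shift
law supplied by `shiftLaws_mixed` (`cm = 2Cst`).  A VARIANT of the B2 slot (c11), off the instance of record; NE2 (U1a) NOT proved by this. [folklore] -/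
theorem balaban_hodge_rate_of_regular (hL : 2 ≤ L) (hd : 1 ≤ d) (h : RegularSites L M Rb α β β₂) {C : ℝ} (hC : 0 ≤ C)
    (hNE3 : LocalRate (bgReadings L M (regClass₂ L M Rb)) C ((L : ℝ)⁻¹)) {a' : ℝ} (ha' : 0 < a')
    {η : ℝ} (hαη : α ≤ η) (hβη : β ≤ η) (hη : η ≤ etaStar o d a a') (hηH : η ≤ 1 / (8 * ((d : ℝ) ^ 2 * Cst d a + 1))) :
    TowerLimitRate (fun k => Qlev L M k ⊗ₖ (1 : Matrix o o ℂ)) ((L : ℝ) ^ d)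
      (fun k => (calDalev L M a ha k ⊗ₖ (1 : Matrix o o ℂ)
        + (1 : ℂ) • (balabanPert L M a (liftR L M Rb) (gaugeSlot L M Rb (QuT L M o (siteT L M Rb)) (Q1 L M o) a') k + hodgeCorr L M Rb k))⁻¹)
      (Cpert (kappaBs o d a α β (a * (epsR o d α * (2 + epsR o d α) * Cst d a)) (kappa4F d a a' α β)
          + (d : ℝ) ^ 2 * ((2 * β + 2 * α ^ 2) * Cst d a)) (2 * d * Cst d a) (CJ d a)
        (C2Bs o d L a α β (betaNE3 o C + β₂)
            (a * C2gram (Cst d a) 1 (epsR o d α) (2 * d * Cst d a) (CJ d a) (Cst d a)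
              (CdeltaR o d a α (theta0 d α (betaNE3 o (betaNE3 o C + β₂)))))
            (C4F o d L a a' α β (betaNE3 o C + β₂))
          + (d : ℝ) ^ 2 * (Cst d a * ((2 * β + 2 * α ^ 2) * (2 * Cst d a)
            + (2 * (betaNE3 o C + β₂) + 4 * α * (betaNE3 o C + β)) * Cst d a)))
        0 1) ((L : ℝ)⁻¹) :=
  NE2BalabanHodge.balaban_hodge_rate_of_regular L M a ha hL hd h hC hNE3 ha' (shiftLaws_mixedShift L M a ha) hαη hβη hη hηH

end Summit.QuantumFields.BalabanUV.T4Continuum.NE2BalabanHodgeShift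

end
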